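import Mathlib
import Summits.NavierStokesRegularity.NavierStokesRegularity.Theses.QuarterLogPincer
import Summits.NavierStokesRegularity.NavierStokesRegularity.Theorems.QuarterLogPincerThinCascadeDefs
import Summits.NavierStokesRegularity.NavierStokesRegularity.Theorems.QuarterLogPincerTypeIQuantSubcubicExpStubCheapCascades
import Summits.NavierStokesRegularity.NavierStokesRegularity.Theorems.QuarterLogPincerTypeIQuantSubcubicExpStubUniformScaledEnergy
import Summits.NavierStokesRegularity.NavierStokesRegularity.Theorems.QuarterLogPincerTypeIQuantSubcubicExpStubThinObjectExtraction
import Summits.NavierStokesRegularity.NavierStokesRegularity.Theorems.DssFarFieldSlavingBlowupTypeIDssProfileSimilarityEnstrophyTimeOnlyThreshold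

/-!
# Line `thin-cascade` for crux `QuarterLogPincer.TypeIQuantSubcubicExp` (stmt-NavierStokesRegularity-24077)

ns-idea-7 (lens «nearmiss», target «DSS wall»).  No summit is proved by this line.

VERSION 6.1 (2026-08-28, lead prover ns-tc-p1 g4: INTEGRATION of the landed stubs; statements of v5
unchanged; 6.1 = S3 docstring lists the landed strata/hardness/rung names).  Registered stubs S1 `stub_cheapCascades` (p608901), I1 `stub_uniformScaledEnergy`
(p619610) and S2 `stub_thinObjectExtraction` (p624656) are THEOREMS of the tree, proved BY NAME with
their registered signatures in `Theorems/QuarterLogPincerTypeIQuantSubcubicExpStub*.lean` over the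
re-homed definitions module `Theorems/QuarterLogPincerThinCascadeDefs.lean` (`TaoFrame`, `CheapCascade`,
`SingularAt`, `ThinObject`, `UniformScaledEnergy` — verbatim v5); this skeleton now IMPORTS them instead
of restating them, so its only `sorry` is the deciding stub S3 `stub_thinCascadeLiouville` (the DSS
wall; registered signature unchanged).  Kernel-checked consequences landed by the lead
(`Theorems/QuarterLogPincerTypeIQuantSubcubicExpLiouvilleTransfer.lean`): S1/S2 at a FIXED Type-I
constant, the transfer «rate-class Type-I Liouville at level M ⇒ the crux's quantitative bound at
level M», and the PROVED RUNG «the crux holds at every M < 1» (`quantSubcubicExpAt_of_lt_one`); the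
crux BY NAME from S3's statement alone is `typeIQuantSubcubicExp_of_thinCascadeLiouville`
(`…LiouvilleEdges.lean`).  The v5 text follows for the record.

Thesis of the line.  The subcubic-exponential Type-I rate `F_M(A) = exp(o(A³))` fails at level `ε`
iff there are smooth Type-I(M) solutions carrying `K ≥ εA³` octaves of concentration above their
regularity scale at bounded AVERAGE final-time L³ cost `≤ 1/ε` per octave ("cheap cascades",
`stub_cheapCascades`, elementary: optimal `F`, restriction in time, discrete maximal
inequality; the cascade centre is a datum, no translation is needed).  Cheap cascades of unbounded length converge, after zooming at a good starting
octave, to a THIN singular Type-I ancient object (`ThinObject`): an ancient mild solution on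
`ℝ³ × (−∞,0)` with the time-Type-I bound `M/√(−t)`, singular at the space–time origin, whose
final-time weak trace `g` deposits at most `q (1 + log R)` of `|g|³` on `1 < |x| < R`
(`stub_thinObjectExtraction`: KNSS slab compactness, Wolf's velocity ε-regularity for
singularity persistence, weak `L²_loc` trace, Fatou).  The deciding obligation is the Liouville
theorem `stub_thinCascadeLiouville`: no such object exists.  It contains the DSS wall (a
nontrivial backward λ-DSS Type-I solution is singular at the origin and its trace is a discretely
homogeneous germ with exactly `log λ · ∮|Γ|³` per λ-octave) and is implied by "no singular
time-Type-I ancient mild solution" (hence by (L)); it excludes from the crux exactly the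
BRANCHING cascades (power-law trace growth), which is what makes it strictly thinner than the
general Type-I Liouville problem.

VERSION 5 (2026-08-28, ns-idea-7 g2 as line owner; decision on ns-tc-p1 g2's S2 INVENTORY /
DECISION WANTED, following idea-crit-7's CRITIC INPUT 06:23:41Z, option (b)).  The dynamical input
both 24077 lines need between STUB 1 and STUB 2 — «the global sup-rate Type-I bound ALONE gives
uniform scaled local energies up to the final time, with a constant depending on `M` only»
(Albritton–Barker 2019 Remark 3.2 records that the LOCAL/ancient version is not known; the tree's
`Literature.Analysis.FluidPDE.scaledEnergies_bounded_of_typeIRate` is the per-vertex, non-uniform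
forward direction and cannot serve a cascade FAMILY `(u_K)_K` with `A_K → ∞`) — is booked ONCE,
by name, as the registered 4th stub `stub_uniformScaledEnergy : UniformScaledEnergy` (size L, no
wall, GLOBAL Tao frame, constant from `M` alone), and STUB 2 now CONSUMES it
(`stub_thinObjectExtraction : UniformScaledEnergy → …`, otherwise verbatim).  STUB 1 (landed
p608901 by ns-tc-p1), STUB 3, the rung and all definitions are unchanged; the composition is
`TypeIQuantSubcubicExp_of : S1 → I1 → S2 → S3 → crux`.  Line `log-blowdown` (same crux,
unregistered) uses the same lemma for the `E`, `D` parts of its STUB 2.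
-/

noncomputable section

set_option linter.dupNamespace false

namespace Summit.NavierStokesRegularity.NavierStokesRegularity.Cruxes.TypeIQuantSubcubicExp.ThinCascade

open MeasureTheory

local notation "E3" => EuclideanSpace ℝ (Fin 3)

/-! ### Landed (imported, no longer restated here)

* `TaoFrame`, `CheapCascade`, `SingularAt`, `ThinObject`, `UniformScaledEnergy` —
  `Theorems/QuarterLogPincerThinCascadeDefs.lean` (p606679/p609137/p610370), verbatim v5;
* STUB 1 `stub_cheapCascades : ¬ TypeIQuantSubcubicExp → ∃ M q, 0 < q ∧ ∀ K, CheapCascade M q K` —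
  p608901;
* STUB I1 `stub_uniformScaledEnergy : UniformScaledEnergy` — p619610;
* STUB 2 `stub_thinObjectExtraction : UniformScaledEnergy → ∀ M q, 0 < q → (∀ K, CheapCascade M q K) →
  ∃ M' q' v g, ThinObject M' q' v g` — p624656.
-/

example : ¬ Summit.NavierStokesRegularity.NavierStokesRegularity.Theses.QuarterLogPincer.TypeIQuantSubcubicExp →
    ∃ M q : ℝ, 0 < q ∧ ∀ K : ℕ, CheapCascade M q K := stub_cheapCascades
example : UniformScaledEnergy := stub_uniformScaledEnergy
example : UniformScaledEnergy → ∀ M q : ℝ, 0 < q → (∀ K : ℕ, CheapCascade M q K) →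
    ∃ (M' q' : ℝ) (v : ℝ → E3 → E3) (g : E3 → E3), ThinObject M' q' v g := stub_thinObjectExtraction

/-- STUB 3 (DECIDING; size XL; ON THE DSS WALL; the ONLY open stub of the line).  THIN-CASCADE
LIOUVILLE: there is no thin singular Type-I ancient object.  Contains `TypeIDSSLiouvilleConjecture` /
KEY-NS #23 (a nontrivial backward-DSS Type-I mild solution is singular at the origin with trace budget
`log λ ∮|Γ|³` per octave); implied by "no singular ancient mild solution with `HasTypeITimeDecay`" and
hence by (L) = stmt-0057 (kernel form: `typeIQuantSubcubicExp_of_typeIAncientLiouville`, edge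
4050 ⇒ 24077); excludes exactly the branching (power-law trace) cascades.  PROVED SUB-CASES (tree):
`M < 1` (`Theorems.ThinCascade.not_thinObject_of_lt_one`, p626481); not `c`-DSS for `1 < c < c₁(M)`
about any centre (LINE 6 rung `AxisActivity.thinObject_not_nearOneDss`, p629934; 24077-side names
`Theorems.ThinCascade.thinObject_not_dss_nearOne(_shift)`, p631569); not backward self-similar
(`Theorems.ThinCascade.thinObject_not_selfSimilar`, p631569).  HARDNESS (ns-afl-r1 g6, p631165):
S3 ⇒ `FiniteDissipationLiouville` (22144) and S3 ≥ `TypeIDSSLiouvilleConjecture` in the kernel.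
RUNG LINE flat_window (ns-idea-7 LINE 7, fully landed p628631/p629490/p630589/p631341/p633176:
`FlatWindow.removingDss_explicitWindow`, explicit near-one window in the ENVELOPE class) does not
narrow S3.  Why it might fail: a backward-DSS Type-I profile of some ratio `λ ≥ λ_*(C)`
(Bradshaw–Tsai 2017 §5; none known, none excluded) refutes it, 24077 and SuperlogCubeRate at once.
Instrument: pub-ns-dss backward-DSS / recurrent Type-I profile searches. -/
theorem stub_thinCascadeLiouville :
    ∀ (M q : ℝ) (v : ℝ → E3 → E3) (g : E3 → E3), ¬ ThinObject M q v g := by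
  sorry

/-- RUNG (proved, small-constant regime): the deciding stub holds for every Type-I constant
`M < 1`, by the tree's time-only small-constant Liouville theorem
`SimilarityEnstrophy.typeI_ancient_eq_zero_of_rate_lt_one` (`IsTypeIAncientMild M v`,
`M < 1` ⇒ `v ≡ 0` on `t < 0`), which is incompatible with `SingularAt v 0`.  (Landed form:
`Theorems.ThinCascade.not_thinObject_of_lt_one`; quantitative consequence landed:
`Theorems.ThinCascade.quantSubcubicExpAt_of_lt_one` — the crux holds at every `M < 1`.) -/
theorem thinCascadeLiouville_of_lt_one (M q : ℝ) (v : ℝ → E3 → E3) (g : E3 → E3) (hM : M < 1) :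
    ¬ ThinObject M q v g := by
  rintro ⟨hv, -, hsing, -⟩
  have h0 := Summit.NavierStokesRegularity.NavierStokesRegularity.Theorems.SimilarityEnstrophy.typeI_ancient_eq_zero_of_rate_lt_one hv hM
  obtain ⟨t, ht, y, -, hy⟩ := hsing 1 one_pos 0
  have hzero : v t y = 0 := h0 t ht.2 y
  simp [hzero] at hy

/-- COMPOSITION (kernel-checked, no `sorry`): the four stubs prove the crux BY NAME
(v5/v6: `S1 → I1 → S2 → S3 → crux`). -/
theorem TypeIQuantSubcubicExp_of :
    (¬ Summit.NavierStokesRegularity.NavierStokesRegularity.Theses.QuarterLogPincer.TypeIQuantSubcubicExp →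
        ∃ M q : ℝ, 0 < q ∧ ∀ K : ℕ, CheapCascade M q K) →
    UniformScaledEnergy →
    (UniformScaledEnergy → ∀ M q : ℝ, 0 < q → (∀ K : ℕ, CheapCascade M q K) →
        ∃ (M' q' : ℝ) (v : ℝ → E3 → E3) (g : E3 → E3), ThinObject M' q' v g) →
    (∀ (M q : ℝ) (v : ℝ → E3 → E3) (g : E3 → E3), ¬ ThinObject M q v g) →
      Summit.NavierStokesRegularity.NavierStokesRegularity.Theses.QuarterLogPincer.TypeIQuantSubcubicExp := by
  intro h₁ hI h₂ h₃
  by_contra h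
  obtain ⟨M, q, hq, hK⟩ := h₁ h
  obtain ⟨M', q', v, g, hv⟩ := h₂ hI M q hq hK
  exact h₃ M' q' v g hv

/-- The composition instantiated with the stubs: S1, I1, S2 are the LANDED theorems (imported by
name), S3 is the open stub above. -/
theorem TypeIQuantSubcubicExp_of_stubs :
    Summit.NavierStokesRegularity.NavierStokesRegularity.Theses.QuarterLogPincer.TypeIQuantSubcubicExp :=
  TypeIQuantSubcubicExp_of stub_cheapCascades stub_uniformScaledEnergy stub_thinObjectExtraction
    stub_thinCascadeLiouville

end Summit.NavierStokesRegularity.NavierStokesRegularity.Cruxes.TypeIQuantSubcubicExp.ThinCascade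

end
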